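import Mathlib.FieldTheory.IsAlgClosed.Basic
import Mathlib.Data.Fintype.Powerset
import Literature.Computability.AlgebraicComplexity.RankMethodBarriers
import Literature.Computability.AlgebraicComplexity.ApolarityBound
import HarnessLib

/-!
# Proof of the rank-method barrier for tensor rank (EGOW 2018, Theorem 4.4)

Topic `Literature/Computability/AlgebraicComplexity`; discharges the named facts `EGOW2018_thm44`
(hence `EGOW2018_thm11`) of `RankMethodBarriers.lean`:
for a linear `L : Ten_{n,d}(F) → Mat_m(F)` with `rk L(u₁ ⊗ ⋯ ⊗ u_d) ≤ r` on rank-one tensors,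
`rk L(T) ≤ r · 2^d · n^{⌊d/2⌋}` for every tensor `T` (`F` algebraically closed of characteristic
zero as printed; the proof uses only that `F` is infinite).

The proof instantiates the apolarity bound `MonomialChart.rank_le_mul_rank_hankel`
(`ApolarityBound.lean`) on the HOMOGENEOUS chart of the Segre variety `(ℙ^{n-1})^d`: variables
`σ = [d] × [n]`, exponents `α(i₁,…,i_d) = Σ_j e_{(j, i_j)}` (degree `d`), points `χ(y) =
u₁ ⊗ ⋯ ⊗ u_d` with `u_j = y(j, ·)`. Support splitting (`MonomialChart.rank_hankel_le` with
`e = ⌊d/2⌋`, `e' = ⌊(d−1)/2⌋`) bounds the Hankel rank by the number of divisors of the monomials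
of degree `≤ e` plus those of degree `≤ e'`; a divisor of degree `s` is a partial selection
`G ⊆ [d]`, `|G| = s`, with `n` choices per selected factor, so the bound is
`(#{G : |G| ≤ ⌊d/2⌋} + #{G : |G| ≤ ⌊(d−1)/2⌋}) · n^{⌊d/2⌋} = 2^d · n^{⌊d/2⌋}` — exactly the count in
EGOW's proof of Thm. 4.4 (sum over the `2^d` bipartitions of the factors of
`min(n^{|G|}, n^{d−|G|}) ≤ n^{⌊d/2⌋}`). [EfremenkoGargOliveiraWigderson2018, Thm. 4.4]
-/

noncomputable section

open scoped BigOperators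

namespace Literature.Computability.AlgebraicComplexity

open MonomialChart

/-! ## Counting subsets of the factors -/

/-- `#{G ⊆ [d] : |G| ≤ ⌊d/2⌋} + #{G ⊆ [d] : |G| ≤ ⌊(d−1)/2⌋} = 2^d` for `d ≥ 1` (complementation
matches the second family with `{G : |G| > ⌊d/2⌋}`). [folklore] -/
theorem card_filter_card_le_half_add {d : ℕ} (hd : 0 < d) :
    ((Finset.univ : Finset (Finset (Fin d))).filter fun G => G.card ≤ d / 2).card +
      ((Finset.univ : Finset (Finset (Fin d))).filter fun G => G.card ≤ (d - 1) / 2).card =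
        2 ^ d := by
  classical
  have hcompl : ((Finset.univ : Finset (Finset (Fin d))).filter
      fun G => G.card ≤ (d - 1) / 2).card =
      ((Finset.univ : Finset (Finset (Fin d))).filter fun G => ¬ G.card ≤ d / 2).card := by
    refine Finset.card_bij' (fun G _ => Gᶜ) (fun G _ => Gᶜ) (fun G hG => ?_) (fun G hG => ?_)
      (fun G _ => compl_compl G) (fun G _ => compl_compl G)
    · simp only [Finset.mem_filter, Finset.mem_univ, true_and] at hG ⊢
      rw [Finset.card_compl, Fintype.card_fin]
      have := G.card_le_univ
      rw [Fintype.card_fin] at this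
      omega
    · simp only [Finset.mem_filter, Finset.mem_univ, true_and] at hG ⊢
      rw [Finset.card_compl, Fintype.card_fin]
      have := G.card_le_univ
      rw [Fintype.card_fin] at this
      omega
  rw [hcompl, Finset.card_filter_add_card_filter_not, Finset.card_univ,
    Fintype.card_finset, Fintype.card_fin]

/-- Partial functions `[d] → [n]` supported on at most `e` points number at most
`#{G ⊆ [d] : |G| ≤ e} · n^e` (for `n ≥ 1`). [folklore] -/
theorem card_filter_support_le (d n e : ℕ) (hn : 0 < n) :
    ((Finset.univ : Finset (Fin d → Option (Fin n))).filter fun g =>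
        (Finset.univ.filter fun j => (g j).isSome).card ≤ e).card ≤
      ((Finset.univ : Finset (Finset (Fin d))).filter fun G => G.card ≤ e).card * n ^ e := by
  classical
  set S := (Finset.univ : Finset (Fin d → Option (Fin n))).filter fun g =>
    (Finset.univ.filter fun j => (g j).isSome).card ≤ e with hS
  set supp : (Fin d → Option (Fin n)) → Finset (Fin d) := fun g =>
    Finset.univ.filter fun j => (g j).isSome with hsupp
  have hfib : ∀ G ∈ S.image supp, (S.filter fun g => supp g = G).card ≤ n ^ e := by
    intro G hG
    obtain ⟨g₀, hg₀, rfl⟩ := Finset.mem_image.1 hG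
    have hGe : (supp g₀).card ≤ e := (Finset.mem_filter.1 hg₀).2
    -- every `g` with support `supp g₀` is the extension of a function `supp g₀ → Fin n`
    set ext : (supp g₀ → Fin n) → (Fin d → Option (Fin n)) := fun h j =>
      if hj : j ∈ supp g₀ then some (h ⟨j, hj⟩) else none with hext
    calc (S.filter fun g => supp g = supp g₀).card
        ≤ ((Finset.univ : Finset (supp g₀ → Fin n)).image ext).card := by
          refine Finset.card_le_card fun g hg => ?_
          rw [Finset.mem_filter] at hg
          rw [Finset.mem_image]
          refine ⟨fun j => (g j.1).getD ⟨0, hn⟩, Finset.mem_univ _, ?_⟩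
          funext j
          simp only [hext]
          by_cases hj : j ∈ supp g₀
          · rw [dif_pos hj]
            have hj' : (g j).isSome := by
              rw [← hg.2] at hj
              exact (Finset.mem_filter.1 hj).2
            obtain ⟨v, hv⟩ := Option.isSome_iff_exists.1 hj'
            simp [hv]
          · rw [dif_neg hj]
            have hj' : ¬ (g j).isSome := by
              rw [← hg.2] at hj
              exact fun h' => hj (Finset.mem_filter.2 ⟨Finset.mem_univ _, h'⟩)
            cases h : g j with
            | none => rfl
            | some v => rw [h] at hj'; exact absurd rfl hj'
      _ ≤ (Finset.univ : Finset (supp g₀ → Fin n)).card := Finset.card_image_le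
      _ = n ^ (supp g₀).card := by
          rw [Finset.card_univ, Fintype.card_fun, Fintype.card_coe, Fintype.card_fin]
      _ ≤ n ^ e := Nat.pow_le_pow_right hn hGe
  calc S.card ≤ n ^ e * (S.image supp).card := Finset.card_le_mul_card_image S (n ^ e) hfib
    _ ≤ n ^ e * ((Finset.univ : Finset (Finset (Fin d))).filter fun G => G.card ≤ e).card := by
        refine Nat.mul_le_mul_left _ (Finset.card_le_card fun G hG => ?_)
        obtain ⟨g, hg, rfl⟩ := Finset.mem_image.1 hG
        exact Finset.mem_filter.2 ⟨Finset.mem_univ _, (Finset.mem_filter.1 hg).2⟩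
    _ = _ := Nat.mul_comm _ _

/-! ## The cube chart and the proof of Theorem 4.4 -/

/-- **Efremenko–Garg–Oliveira–Wigderson 2018, Theorem 4.4, proved.**
[cite: EfremenkoGargOliveiraWigderson2018, Thm 4.4] -/
theorem EGOW2018_thm44_holds : EGOW2018_thm44 := by
  intro F _ _ _ m n d _ hn L r hr T
  classical
  rcases Nat.eq_zero_or_pos d with hd0 | hd
  · -- `d = 0`: every tensor is a multiple of the (unique) rank-one tensor
    subst hd0
    let u₀ : Fin 0 → Fin n → F := fun j => Fin.elim0 j
    have hT : T = T (fun j => Fin.elim0 j) • rankOneTensor u₀ := by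
      funext i
      have hi : i = fun j => Fin.elim0 j := funext fun j => Fin.elim0 j
      subst hi
      simp [rankOneTensor_apply]
    rw [hT, map_smul]
    calc ((T fun j => Fin.elim0 j) • L (rankOneTensor u₀)).rank
        ≤ (L (rankOneTensor u₀)).rank := by
          by_cases hc : T (fun j => Fin.elim0 j) = 0
          · simp [hc]
          · have : (T fun j => Fin.elim0 j) • L (rankOneTensor u₀) =
                Matrix.diagonal (fun _ : Fin m => T fun j => Fin.elim0 j) *
                  L (rankOneTensor u₀) := by
              rw [← Matrix.smul_eq_diagonal_mul]
            rw [this]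
            exact Matrix.rank_mul_le_right _ _
      _ ≤ r := hr u₀
      _ = r * 2 ^ 0 * n ^ (0 / 2) := by simp
  · -- the homogeneous cube chart
    let σ := Fin d × Fin n
    let α : (Fin d → Fin n) → σ →₀ ℕ := fun idx => ∑ j, Finsupp.single (j, idx j) 1
    have hα_apply : ∀ idx (j : Fin d) (v : Fin n),
        α idx (j, v) = if idx j = v then 1 else 0 := by
      intro idx j v
      simp only [α, Finsupp.coe_finsetSum, Finset.sum_apply]
      rw [Finset.sum_eq_single j]
      · rw [Finsupp.single_apply]
        by_cases hv : idx j = v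
        · rw [if_pos (by rw [hv]), if_pos hv]
        · rw [if_neg (fun h => hv (Prod.mk.inj h).2), if_neg hv]
      · intro j' _ hj'
        rw [Finsupp.single_apply, if_neg]
        exact fun h => hj' (Prod.mk.inj h).1
      · intro h; exact absurd (Finset.mem_univ j) h
    have hα : Function.Injective α := by
      intro idx idx' h
      funext j
      have := congrArg (fun β => β (j, idx j)) h
      simp only [hα_apply] at this
      by_contra hne
      rw [if_neg (Ne.symm hne)] at this
      exact one_ne_zero this
    have hdeg : ∀ idx, (α idx).degree = d := by
      intro idx
      simp only [α, map_sum, Finsupp.degree_single, Finset.sum_const, Finset.card_univ,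
        Fintype.card_fin, smul_eq_mul, mul_one]
    have hpt : ∀ y : σ → F, point α y = rankOneTensor fun j v => y (j, v) := by
      intro y
      funext idx
      rw [point_apply, rankOneTensor_apply]
      change ∏ s, y s ^ ((∑ j, Finsupp.single (j, idx j) 1 : σ →₀ ℕ) s) = _
      rw [prod_pow_sum]
      exact Finset.prod_congr rfl fun j _ => prod_pow_single y _
    have hk : ∀ y : σ → F, (L (point α y)).rank ≤ r := fun y => by rw [hpt]; exact hr _
    have hmain := rank_le_mul_rank_hankel hα L r hk T
    -- the count
    have hcount : ∀ e, e ≤ d / 2 → ((downClosure α).filter fun β => β.degree ≤ e).card ≤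
        ((Finset.univ : Finset (Finset (Fin d))).filter fun G => G.card ≤ e).card *
          n ^ (d / 2) := by
      intro e he
      -- every divisor of an `α idx` is a partial selection
      set Φ : (Fin d → Option (Fin n)) → σ →₀ ℕ := fun g =>
        ∑ j, (g j).elim 0 fun v => Finsupp.single (j, v) 1 with hΦ
      set wt : (Fin d → Option (Fin n)) → ℕ := fun g =>
        (Finset.univ.filter fun j => (g j).isSome).card with hwt
      have hsel : ∀ β ∈ downClosure α, ∃ g, Φ g = β ∧ wt g = β.degree := by
        intro β hβ
        obtain ⟨idx, hle⟩ := mem_downClosure.1 hβ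
        have hβv : ∀ j v, idx j ≠ v → β (j, v) = 0 := by
          intro j v h
          have := hle (j, v)
          rwa [hα_apply, if_neg h, Nat.le_zero] at this
        have hβ1 : ∀ j, β (j, idx j) ≤ 1 := fun j => by
          have := hle (j, idx j); rwa [hα_apply, if_pos rfl] at this
        refine ⟨fun j => if β (j, idx j) = 0 then none else some (idx j), ?_, ?_⟩
        · ext ⟨j, v⟩
          simp only [hΦ, Finsupp.coe_finsetSum, Finset.sum_apply]
          rw [Finset.sum_eq_single j]
          · by_cases h0 : β (j, idx j) = 0
            · rw [if_pos h0]
              by_cases hv : idx j = v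
              · rw [← hv, h0]; rfl
              · rw [hβv j v hv]; rfl
            · rw [if_neg h0]
              have h1 : β (j, idx j) = 1 := by have := hβ1 j; omega
              change Finsupp.single (j, idx j) 1 (j, v) = β (j, v)
              rw [Finsupp.single_apply]
              by_cases hv : idx j = v
              · rw [if_pos (by rw [hv]), ← hv, h1]
              · rw [if_neg (fun h => hv (Prod.mk.inj h).2), hβv j v hv]
          · intro j' _ hj'
            by_cases h0 : β (j', idx j') = 0
            · rw [if_pos h0]; rfl
            · rw [if_neg h0]
              change Finsupp.single (j', idx j') 1 (j, v) = 0
              rw [Finsupp.single_apply, if_neg]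
              exact fun h => hj' (Prod.mk.inj h).1
          · intro h; exact absurd (Finset.mem_univ j) h
        · rw [Finsupp.degree_eq_sum, Fintype.sum_prod_type]
          simp only [hwt]
          rw [Finset.card_filter]
          refine Finset.sum_congr rfl fun j _ => ?_
          rw [Finset.sum_eq_single (idx j)]
          · by_cases h0 : β (j, idx j) = 0
            · simp [h0]
            · have h1 : β (j, idx j) = 1 := by have := hβ1 j; omega
              simp [h1]
          · intro v _ hv; exact hβv j v (Ne.symm hv)
          · intro h; exact absurd (Finset.mem_univ _) h
      calc ((downClosure α).filter fun β => β.degree ≤ e).card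
          ≤ (((Finset.univ : Finset (Fin d → Option (Fin n))).filter fun g => wt g ≤ e).image
              Φ).card := by
            refine Finset.card_le_card fun β hβ => ?_
            rw [Finset.mem_filter] at hβ
            obtain ⟨g, hg, hwg⟩ := hsel β hβ.1
            exact Finset.mem_image.2 ⟨g, Finset.mem_filter.2 ⟨Finset.mem_univ _, by omega⟩, hg⟩
        _ ≤ ((Finset.univ : Finset (Fin d → Option (Fin n))).filter fun g => wt g ≤ e).card :=
            Finset.card_image_le
        _ ≤ ((Finset.univ : Finset (Finset (Fin d))).filter fun G => G.card ≤ e).card * n ^ e :=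
            card_filter_support_le d n e hn
        _ ≤ _ := Nat.mul_le_mul_left _ (Nat.pow_le_pow_right hn he)
    have hH : (hankel α T).rank ≤ 2 ^ d * n ^ (d / 2) := by
      refine (rank_hankel_le α T (d / 2) ((d - 1) / 2) fun idx => by rw [hdeg]; omega).trans ?_
      have h1 := hcount (d / 2) le_rfl
      have h2 := hcount ((d - 1) / 2) (by omega)
      have h3 := card_filter_card_le_half_add hd
      calc _ ≤ ((Finset.univ : Finset (Finset (Fin d))).filter fun G => G.card ≤ d / 2).card *
              n ^ (d / 2) +
            ((Finset.univ : Finset (Finset (Fin d))).filter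
              fun G => G.card ≤ (d - 1) / 2).card * n ^ (d / 2) := add_le_add h1 h2
        _ = 2 ^ d * n ^ (d / 2) := by rw [← add_mul, h3]
    calc (L T).rank ≤ r * (hankel α T).rank := hmain
      _ ≤ r * (2 ^ d * n ^ (d / 2)) := Nat.mul_le_mul_left r hH
      _ = r * 2 ^ d * n ^ (d / 2) := by ring

/-- **EGOW 2018, Theorem 1.1 / Corollary 4.5, proved.**
[cite: EfremenkoGargOliveiraWigderson2018, Thm 1.1] -/
theorem EGOW2018_thm11_holds : EGOW2018_thm11 :=
  EGOW2018_thm44_holds.thm11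

end Literature.Computability.AlgebraicComplexity

end
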